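import Summits.FinalStateConjecture.FinalStateConjecture.Theses.KerrnessPropagates
import Summits.FinalStateConjecture.FinalStateConjecture.Theorems.KerrnessPropagatesKerrBasinCaptureStubReanchorMapExists

/-!
# Route `KerrnessPropagates`, crux `KerrBasinCapture` (stmt-FinalStateConjecture-17646), line `registered`
# (skeleton `Cruxes/KerrBasinCapture/Lines/birth.lean`, lead rev 7) — stub `stub_reanchorMapShear`

**The global re-anchoring map, with the canonical shear frame made explicit.** To transfer the
hand-over slabs of the `n`-th multi-Kerr configuration `(Λₙⱼ, cₙⱼ)ⱼ` to the limit configuration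
`(Λₗⱼ, cₗⱼ)ⱼ` one precomposes the chart with ONE diffeomorphism `Θ` of a lab-time slab of `E4`
which, on the lab ball of radius `ϱ` about the position `Xₗⱼ` of each limit hole at lab time `τ`,
is the affine Poincaré re-gauging `Θⱼ = Pₙⱼ ∘ Sⱼ ∘ Pₗⱼ⁻¹` with the rest-frame TIME SHEAR
`Sⱼ y = y + (φⱼ y + βⱼ) e₀`, `φⱼ = κ⁻¹ (dx⁰ ∘ Λₗⱼ − dx⁰ ∘ Λₙⱼ)`, `βⱼ = κ⁻¹ (cₗⱼ⁰ − cₙⱼ⁰)`,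
`κ = (Λₙⱼ e₀)⁰`, glued to the identity in between by spatial bump functions.

This is the companion of the landed `stub_reanchorMapExists`
(`Theorems/KerrnessPropagatesKerrBasinCaptureStubReanchorMapExists.lean`): same hypotheses, same
construction, but the conclusion no longer hides the frame map behind an existential — it is the
EXPLICIT continuous linear map
`TFMⱼ = (id + (κ⁻¹ (dx⁰ ∘ Λₗⱼ − dx⁰ ∘ Λₙⱼ)) ⊗ e₀) ∘ Λₗⱼ⁻¹`,
so that downstream (i) `TFMⱼ v` and `Λₗⱼ⁻¹ v` visibly have the same spatial part and (ii) `TFMⱼ`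
depends on the configuration index only. The proof re-runs the assembly of the landed file — its
per-hole affine algebra `rme_poincareInv_affine`, `rme_frame_apply_lorentz_basisVector`,
`rme_norm_frame_sub_le`, `rme_norm_lin_sub_id_le`, `rme_affine_apply_zero` (imported, the frame
data `T, L, w` enter them as variables with defining equations), the generic partition-of-unity
gluing theorem `Literature.Analysis.Calculus.exists_affine_bump_gluing` (closeness `a = 16 L₀² δ`,
`δ = min η ½ / (16 L₀² K)`) and the inverse-function-theorem packaging
`Literature.Analysis.Calculus.isOpenEmbedding_restrict_of_norm_fderiv_sub_id_le` — with the
witness `T j := TFMⱼ` substituted into the goal (`dx⁰ ∘ (Λₗ − Λₙ) = dx⁰ ∘ Λₗ − dx⁰ ∘ Λₙ` is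
`ContinuousLinearMap.comp_sub`).

Sources: O'Neill, *Semi-Riemannian Geometry* (1983), Ch. 9, pp. 233–236 (Lorentz and Poincaré
motions); Lee, *Introduction to Smooth Manifolds* (2013), Lemma 2.26 (gluing by bump functions).
-/

open scoped BigOperators Topology Manifold Classical Matrix InnerProductSpace ContinuousMap
open Filter Set Function TopologicalSpace
open Literature.Geometry.Lorentzian

-- D-0017: single-problem summit, `Summit.<S>.<S>.…` by design.
set_option linter.dupNamespace false

namespace Summit.FinalStateConjecture.FinalStateConjecture.Theorems.KerrnessPropagates.KerrBasinCapture

/-- stub A′ — **THE GLOBAL RE-ANCHORING MAP WITH THE CANONICAL SHEAR FRAME** (registered stub of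
crux stmt-FinalStateConjecture-17646, line `registered`). Given `k, N, L₀, η` there is `δ > 0` such
that for two `N`-hole multi-Kerr motions `(Λₙ, cₙ)`, `(Λₗ, cₗ)` with boosts of operator norm `≤ L₀`
that are `δ`-close, lab positions at lab time `τ` that are `δϱ`-close, and limit holes
`16ϱ`-separated, one smooth map `Θ` of `E4` preserves lab time, is `η`-close to the identity in
`C^{k+1}` (and moves points by `≤ ηϱ`) on the slab `{|x⁰ − τ| < 1}`, is an open embedding there,
and on the lab ball of radius `ϱ` about each limit hole equals the affine Poincaré re-gauging
`Pₙⱼ ∘ Sⱼ ∘ Pₗⱼ⁻¹` whose frame map is the explicit shear frame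
`(id + (κ⁻¹ (dx⁰ ∘ Λₗⱼ − dx⁰ ∘ Λₙⱼ)) ⊗ e₀) ∘ Λₗⱼ⁻¹`, `κ = (Λₙⱼ e₀)⁰`. Proof: the per-hole affine
algebra of the landed `stub_reanchorMapExists` file, glued by
`Literature.Analysis.Calculus.exists_affine_bump_gluing`; the embedding by
`isOpenEmbedding_restrict_of_norm_fderiv_sub_id_le`. [folklore] -/
theorem stub_reanchorMapShear : ∀ (k N : ℕ) (L₀ η : ℝ), 1 ≤ L₀ → 0 < η → ∃ δ : ℝ, 0 < δ ∧ ∀ (Λn Λl : Fin N → ↥lorentzGroup) (cn cl : Fin N → E4) (τ ϱ : ℝ), 1 ≤ ϱ → (∀ j, ‖(((Λl j : ↥lorentzGroup) : E4 ≃L[ℝ] E4) : E4 →L[ℝ] E4)‖ ≤ L₀ ∧ ‖((((Λl j : ↥lorentzGroup) : E4 ≃L[ℝ] E4)).symm : E4 →L[ℝ] E4)‖ ≤ L₀ ∧ ‖(((Λn j : ↥lorentzGroup) : E4 ≃L[ℝ] E4) : E4 →L[ℝ] E4)‖ ≤ L₀ ∧ ‖(((Λn j : ↥lorentzGroup) :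 E4 ≃L[ℝ] E4) : E4 →L[ℝ] E4) - (((Λl j : ↥lorentzGroup) : E4 ≃L[ℝ] E4) : E4 →L[ℝ] E4)‖ ≤ δ) → (∀ j, ‖(E4.spatial (cn j) + ((τ) - (cn j) 0) • (((((Λn j : ↥lorentzGroup) : E4 ≃L[ℝ] E4)) (E4.basisVector 0) 0)⁻¹ • E4.spatial ((((Λn j : ↥lorentzGroup) : E4 ≃L[ℝ] E4)) (E4.basisVector 0)))) - (E4.spatial (cl j) + ((τ) - (cl j) 0) • (((((Λl j : ↥lorentzGroup) : E4 ≃L[ℝ] E4)) (E4.basisVector 0) 0)⁻¹ • E4.spatial ((((Λl j : ↥lorentzGroup) : E4 ≃L[ℝ] E4)) (E4.basisVector 0))))‖ ≤ δ * ϱ) → (∀ i j, i ≠ j → 16 * ϱ ≤ ‖(E4.spatial (cl i) + ((τ) - (cl i) 0) • (((((Λl i : ↥lorentzGroup) : E4 ≃L[ℝ] E4)) (E4.basisVector 0) 0)⁻¹ • E4.spatial ((((Λl i : ↥lorentzGroup) : E4 ≃L[ℝ] E4)) (E4.basisVector 0)))) - (E4.spatial (cl j) + ((τ) - (cl j) 0)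 • (((((Λl j : ↥lorentzGroup) : E4 ≃L[ℝ] E4)) (E4.basisVector 0) 0)⁻¹ • E4.spatial ((((Λl j : ↥lorentzGroup) : E4 ≃L[ℝ] E4)) (E4.basisVector 0))))‖) → ∃ (Θ : E4 → E4) (β : Fin N → ℝ), ContDiff ℝ (⊤ : ℕ∞) Θ ∧ (∀ x, (Θ x) 0 = x 0) ∧ (∀ x : E4, |x 0 - τ| < 1 → ‖fderiv ℝ Θ x - ContinuousLinearMap.id ℝ E4‖ ≤ η ∧ ‖Θ x - x‖ ≤ η * ϱ ∧ ∀ m : ℕ, 2 ≤ m → m ≤ k + 1 → ‖iteratedFDeriv ℝ m Θ x‖ ≤ η) ∧ Topology.IsOpenEmbedding ({x : E4 | |x 0 - τ| < 1}.restrict Θ) ∧ (∀ j, ∀ x : E4, |x 0 - τ| < 1 → ‖E4.spatial x - (E4.spatial (cl j) + ((τ) - (cl j) 0) • (((((Λl j : ↥lorentzGroup) : E4 ≃L[ℝ] E4)) (E4.basisVector 0) 0)⁻¹ • E4.spatial ((((Λl j : ↥lorentzGroup) : E4 ≃L[ℝ] E4)) (E4.basisVector 0))))‖ ≤ ϱ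 → fderiv ℝ Θ x = (((Λn j : ↥lorentzGroup) : E4 ≃L[ℝ] E4) : E4 →L[ℝ] E4).comp ((ContinuousLinearMap.id ℝ E4 + (((((Λn j : ↥lorentzGroup) : E4 ≃L[ℝ] E4) (E4.basisVector 0)) 0)⁻¹ • ((E4.dx 0).comp (((Λl j : ↥lorentzGroup) : E4 ≃L[ℝ] E4) : E4 →L[ℝ] E4) - (E4.dx 0).comp (((Λn j : ↥lorentzGroup) : E4 ≃L[ℝ] E4) : E4 →L[ℝ] E4))).smulRight (E4.basisVector 0)).comp ((((Λl j : ↥lorentzGroup) : E4 ≃L[ℝ] E4)).symm : E4 →L[ℝ] E4)) ∧ poincareInv (Λn j) (cn j) (Θ x) = ((ContinuousLinearMap.id ℝ E4 + (((((Λn j : ↥lorentzGroup) : E4 ≃L[ℝ] E4) (E4.basisVector 0)) 0)⁻¹ • ((E4.dx 0).comp (((Λl j : ↥lorentzGroup) : E4 ≃L[ℝ] E4) : E4 →L[ℝ] E4) - (E4.dx 0).comp (((Λn j : ↥lorentzGroup) : E4 ≃L[ℝ] E4) : E4 →L[ℝ] E4))).smulRight (E4.basisVector 0)).comp ((((Λl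 j : ↥lorentzGroup) : E4 ≃L[ℝ] E4)).symm : E4 →L[ℝ] E4)) (x - cl j) + β j • E4.basisVector 0) := by
  intro k N L₀ η hL₀ hη
  obtain ⟨K, hK1, hK⟩ :=
    Literature.Analysis.Calculus.exists_affine_bump_gluing (E := E4) (S := E3) k (Fin N)
  have hK0 : 0 < K := one_pos.trans_le hK1
  have hL₀0 : 0 < L₀ := one_pos.trans_le hL₀
  have hL₀2 : L₀ ≤ L₀ ^ 2 := by nlinarith
  obtain ⟨ε, hε0, hεη, hε2⟩ : ∃ ε : ℝ, 0 < ε ∧ ε ≤ η ∧ ε ≤ 1 / 2 :=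
    ⟨min η (1 / 2), lt_min hη (by norm_num), min_le_left _ _, min_le_right _ _⟩
  refine ⟨ε / (16 * L₀ ^ 2 * K), by positivity, ?_⟩
  set δ : ℝ := ε / (16 * L₀ ^ 2 * K) with hδ
  intro Λn Λl cn cl τ ϱ hϱ hΛ hX hsep
  have hϱ0 : 0 < ϱ := one_pos.trans_le hϱ
  have hδ0 : 0 < δ := by positivity
  have hKδ : K * (16 * L₀ ^ 2 * δ) = ε := by rw [hδ]; field_simp
  have hδL : L₀ * δ ≤ ε := by
    rw [← hKδ]
    have : L₀ ≤ K * (16 * L₀ ^ 2) := by nlinarith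
    nlinarith
  have hδ1 : δ ≤ 1 := by nlinarith
  /- fold the lab positions -/
  obtain ⟨Xl, hXl⟩ : ∃ Xl : Fin N → E3, ∀ j, Xl j = E4.spatial (cl j) + (τ - (cl j) 0) •
      (((((Λl j : ↥lorentzGroup) : E4 ≃L[ℝ] E4)) (E4.basisVector 0) 0)⁻¹ •
        E4.spatial ((((Λl j : ↥lorentzGroup) : E4 ≃L[ℝ] E4)) (E4.basisVector 0))) :=
    ⟨_, fun _ ↦ rfl⟩
  obtain ⟨Xn, hXn⟩ : ∃ Xn : Fin N → E3, ∀ j, Xn j = E4.spatial (cn j) + (τ - (cn j) 0) •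
      (((((Λn j : ↥lorentzGroup) : E4 ≃L[ℝ] E4)) (E4.basisVector 0) 0)⁻¹ •
        E4.spatial ((((Λn j : ↥lorentzGroup) : E4 ≃L[ℝ] E4)) (E4.basisVector 0))) :=
    ⟨_, fun _ ↦ rfl⟩
  simp only [← hXl, ← hXn] at hX hsep ⊢
  /- the per-hole shear data (the covector `φ j` in the split form of the statement) -/
  obtain ⟨φ, hφ⟩ : ∃ φ : Fin N → E4 →L[ℝ] ℝ, ∀ j, φ j =
      (((Λn j : E4 ≃L[ℝ] E4) (E4.basisVector 0)) 0)⁻¹ •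
        ((E4.dx 0).comp ((Λl j : E4 ≃L[ℝ] E4) : E4 →L[ℝ] E4) -
          (E4.dx 0).comp ((Λn j : E4 ≃L[ℝ] E4) : E4 →L[ℝ] E4)) :=
    ⟨_, fun _ ↦ rfl⟩
  have hφ' : ∀ j, φ j = (((Λn j : E4 ≃L[ℝ] E4) (E4.basisVector 0)) 0)⁻¹ • ((E4.dx 0).comp
      (((Λl j : E4 ≃L[ℝ] E4) : E4 →L[ℝ] E4) - ((Λn j : E4 ≃L[ℝ] E4) : E4 →L[ℝ] E4))) := fun j ↦ by
    rw [hφ j, ContinuousLinearMap.comp_sub]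
  obtain ⟨β, hβ⟩ : ∃ β : Fin N → ℝ, ∀ j, β j =
      (((Λn j : E4 ≃L[ℝ] E4) (E4.basisVector 0)) 0)⁻¹ * (cl j 0 - cn j 0) := ⟨_, fun _ ↦ rfl⟩
  obtain ⟨T, hT⟩ : ∃ T : Fin N → E4 →L[ℝ] E4, ∀ j, T j =
      (ContinuousLinearMap.id ℝ E4 + (φ j).smulRight (E4.basisVector 0)).comp
        (((Λl j : E4 ≃L[ℝ] E4).symm : E4 ≃L[ℝ] E4) : E4 →L[ℝ] E4) := ⟨_, fun _ ↦ rfl⟩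
  obtain ⟨L, hL⟩ : ∃ L : Fin N → E4 →L[ℝ] E4, ∀ j, L j =
      ((Λn j : E4 ≃L[ℝ] E4) : E4 →L[ℝ] E4).comp (T j) := ⟨_, fun _ ↦ rfl⟩
  obtain ⟨w, hw⟩ : ∃ w : Fin N → E4, ∀ j, w j =
      (Λn j : E4 ≃L[ℝ] E4) (β j • E4.basisVector 0) + cn j - L j (cl j) := ⟨_, fun _ ↦ rfl⟩
  /- per-hole estimates -/
  have hφn : ∀ j, ‖φ j‖ ≤ δ := by
    intro j
    obtain ⟨-, -, -, h4⟩ := hΛ j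
    rw [hφ' j, norm_smul, norm_inv, Real.norm_eq_abs]
    have hcomp : ‖(E4.dx 0).comp (((Λl j : E4 ≃L[ℝ] E4) : E4 →L[ℝ] E4) -
        ((Λn j : E4 ≃L[ℝ] E4) : E4 →L[ℝ] E4))‖ ≤ δ := by
      refine (ContinuousLinearMap.opNorm_comp_le _ _).trans ?_
      rw [norm_sub_rev]
      calc ‖E4.dx 0‖ * _ ≤ 1 * δ :=
            mul_le_mul SublinearIsFree.Slaving.momCap_norm_dx_zero_le h4 (norm_nonneg _) zero_le_one
        _ = δ := one_mul δ
    calc _ ≤ 1 * δ := mul_le_mul (inv_le_one_of_one_le₀ (one_le_abs_lorentz_apply_zero (Λn j)))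
          hcomp (norm_nonneg _) zero_le_one
      _ = δ := one_mul δ
  have hTn : ∀ j, ‖T j - (((Λl j : E4 ≃L[ℝ] E4).symm : E4 ≃L[ℝ] E4) : E4 →L[ℝ] E4)‖ ≤ ε := by
    intro j
    refine (rme_norm_frame_sub_le (hT j)).trans ?_
    calc ‖φ j‖ * _ ≤ δ * L₀ := mul_le_mul (hφn j) (hΛ j).2.1 (norm_nonneg _) hδ0.le
      _ ≤ ε := by linarith
  have hLn : ∀ j, ‖L j - ContinuousLinearMap.id ℝ E4‖ ≤ 3 * L₀ ^ 2 * δ := by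
    intro j
    obtain ⟨h1, h2, -, h4⟩ := hΛ j
    refine (rme_norm_lin_sub_id_le (hT j) (hL j)).trans ?_
    have hφ1 : ‖φ j‖ ≤ 1 := (hφn j).trans hδ1
    have hφ0 := norm_nonneg (φ j)
    have hA : ‖((Λn j : E4 ≃L[ℝ] E4) : E4 →L[ℝ] E4) - ((Λl j : E4 ≃L[ℝ] E4) : E4 →L[ℝ] E4)‖ *
        (1 + ‖φ j‖) + ‖((Λl j : E4 ≃L[ℝ] E4) : E4 →L[ℝ] E4)‖ * ‖φ j‖ ≤ δ * 2 + L₀ * δ := by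
      have := hφn j
      nlinarith [norm_nonneg (((Λn j : E4 ≃L[ℝ] E4) : E4 →L[ℝ] E4) -
        ((Λl j : E4 ≃L[ℝ] E4) : E4 →L[ℝ] E4)), norm_nonneg ((Λl j : E4 ≃L[ℝ] E4) : E4 →L[ℝ] E4)]
    calc _ ≤ (δ * 2 + L₀ * δ) * L₀ := mul_le_mul hA h2 (norm_nonneg _) (by positivity)
      _ ≤ 3 * L₀ ^ 2 * δ := by nlinarith
  have htime : ∀ j y, (L j y + w j) 0 = y 0 := fun j y ↦
    rme_affine_apply_zero (hT j) (hL j) (hw j) (hφ' j) (hβ j) y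
  /- the anchor points `x̂ⱼ = (τ, Xl j)` on the limit worldlines and their images `(τ, Xn j)` -/
  have hanchor : ∀ j, ∃ xa : E4, xa 0 = τ ∧ E4.spatial xa = Xl j ∧ ‖L j xa + w j - xa‖ ≤ δ * ϱ := by
    intro j
    have hκl := rme_lorentz_apply_zero_ne_zero (Λl j)
    set s : ℝ := (τ - cl j 0) * (((Λl j : E4 ≃L[ℝ] E4) (E4.basisVector 0)) 0)⁻¹ with hs
    set xa : E4 := (Λl j : E4 ≃L[ℝ] E4) (s • E4.basisVector 0) + cl j with hxa
    have ht : xa 0 = τ := by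
      rw [hxa, map_smul, PiLp.add_apply, PiLp.smul_apply, smul_eq_mul, hs]
      field_simp
      ring
    have hsp : E4.spatial xa = Xl j := by
      rw [hXl j]; exact rme_spatial_worldline (Λl j) (cl j) s τ ht
    -- the image lies on the `n`-th worldline, at lab time `τ`
    set t' : ℝ := s * (1 + φ j (E4.basisVector 0)) + β j with ht'
    have hq : L j xa + w j = (Λn j : E4 ≃L[ℝ] E4) (t' • E4.basisVector 0) + cn j := by
      have e : L j xa + w j =
          (Λn j : E4 ≃L[ℝ] E4) (poincareInv (Λn j) (cn j) (L j xa + w j)) + cn j := by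
        simp [poincareInv]
      rw [e, rme_poincareInv_affine (hL j) (hw j) xa, show xa - cl j =
          (Λl j : E4 ≃L[ℝ] E4) (s • E4.basisVector 0) by rw [hxa]; abel, map_smul, map_smul,
        rme_frame_apply_lorentz_basisVector (hT j), smul_smul, ← add_smul]
    have hq0 : ((Λn j : E4 ≃L[ℝ] E4) (t' • E4.basisVector 0) + cn j) 0 = τ := by
      rw [← hq, htime, ht]
    have hsp' : E4.spatial (L j xa + w j) = Xn j := by
      rw [hq, hXn j]; exact rme_spatial_worldline (Λn j) (cn j) t' τ hq0
    refine ⟨xa, ht, hsp, ?_⟩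
    calc ‖L j xa + w j - xa‖ ≤ |(L j xa + w j - xa) 0| + ‖E4.spatial (L j xa + w j - xa)‖ :=
        rme_norm_le_abs_add_norm_spatial _
      _ = ‖Xn j - Xl j‖ := by
        rw [PiLp.sub_apply, htime, sub_self, abs_zero, zero_add, map_sub, hsp, hsp']
      _ ≤ δ * ϱ := hX j
  /- hypotheses of the gluing theorem, with closeness `a = 16 L₀² δ` -/
  have ha : 0 ≤ 16 * L₀ ^ 2 * δ := by positivity
  have hLa : ∀ i, ‖L i - ContinuousLinearMap.id ℝ E4‖ ≤ 16 * L₀ ^ 2 * δ := fun i ↦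
    (hLn i).trans (by nlinarith)
  have hnear : ∀ i, ∀ y ∈ {x : E4 | |x 0 - τ| < 1}, ‖E4.spatial y - Xl i‖ ≤ 4 * ϱ →
      ‖L i y + w i - y‖ ≤ 16 * L₀ ^ 2 * δ * ϱ := by
    intro i y hy hyi
    have hy' : |y 0 - τ| < 1 := hy
    obtain ⟨xa, hxa0, hxas, hxad⟩ := hanchor i
    have e : L i y + w i - y =
        (L i xa + w i - xa) + (L i - ContinuousLinearMap.id ℝ E4) (y - xa) := by
      simp only [map_sub, sub_apply, ContinuousLinearMap.id_apply]
      abel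
    have hdist : ‖y - xa‖ ≤ 1 + 4 * ϱ := by
      refine (rme_norm_le_abs_add_norm_spatial _).trans ?_
      rw [PiLp.sub_apply, hxa0, map_sub, hxas]
      linarith [hy'.le]
    have h2 : ‖(L i - ContinuousLinearMap.id ℝ E4) (y - xa)‖ ≤ 3 * L₀ ^ 2 * δ * (1 + 4 * ϱ) :=
      (ContinuousLinearMap.le_opNorm _ _).trans
        (mul_le_mul (hLn i) hdist (norm_nonneg _) (by positivity))
    rw [e]
    refine (norm_add_le _ _).trans ?_
    have h3 : δ * ϱ ≤ L₀ ^ 2 * δ * ϱ := by nlinarith [mul_pos hδ0 hϱ0]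
    have h4 : 3 * L₀ ^ 2 * δ * (1 + 4 * ϱ) ≤ 15 * L₀ ^ 2 * δ * ϱ := by
      have : 0 ≤ L₀ ^ 2 * δ := by positivity
      nlinarith
    linarith
  obtain ⟨Θ, hΘs, hΘform, hΘbd, hΘloc⟩ := hK E4.spatial Xl ϱ (16 * L₀ ^ 2 * δ) L w
    {x : E4 | |x 0 - τ| < 1} rme_norm_spatial_le hϱ ha hsep hLa hnear
  rw [hKδ] at hΘbd
  /- the slab is open and convex -/
  have hΩeq : {x : E4 | |x 0 - τ| < 1} = (E4.dx 0) ⁻¹' Metric.ball τ 1 := by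
    ext x; simp [Real.dist_eq]
  have hΩo : IsOpen {x : E4 | |x 0 - τ| < 1} := by
    rw [hΩeq]; exact Metric.isOpen_ball.preimage (E4.dx 0).continuous
  have hΩc : Convex ℝ {x : E4 | |x 0 - τ| < 1} := by
    rw [hΩeq]; exact (convex_ball τ 1).linear_preimage ((E4.dx 0 : E4 →L[ℝ] ℝ) : E4 →ₗ[ℝ] ℝ)
  refine ⟨Θ, β, hΘs, fun y ↦ ?_, fun x hx ↦ ?_, ?_, fun j x _ hxj ↦ ?_⟩
  · -- lab time is preserved
    obtain ⟨c, hc⟩ := hΘform y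
    have key : ∀ i, (c i • (L i y + w i - y)) 0 = 0 := fun i ↦ by
      rw [PiLp.smul_apply, PiLp.sub_apply, htime, sub_self, smul_zero]
    rw [hc, PiLp.add_apply, WithLp.ofLp_sum, Finset.sum_apply,
      Finset.sum_eq_zero fun i _ ↦ key i, add_zero]
  · -- `C^{k+1}`-closeness to the identity on the slab
    obtain ⟨h1, h2, h3⟩ := hΘbd x hx
    exact ⟨h1.trans hεη, h2.trans (mul_le_mul_of_nonneg_right hεη hϱ0.le),
      fun m hm hmk ↦ (h3 m hm hmk).trans hεη⟩
  · -- open embedding of the slab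
    exact Literature.Analysis.Calculus.isOpenEmbedding_restrict_of_norm_fderiv_sub_id_le hΩo hΩc
      (fun x _ ↦ (hΘs.differentiable (by simp)).differentiableAt)
      fun x hx ↦ (hΘbd x hx).1.trans hε2
  · -- on the `j`-th ball `Θ` is the affine re-gauging with the explicit shear frame `T j`
    obtain ⟨hd, hv⟩ := hΘloc j x hxj
    refine ⟨?_, ?_⟩
    · rw [hd, hL j, hT j, hφ j]
    · rw [hv, rme_poincareInv_affine (hL j) (hw j) x, hT j, hφ j]

end Summit.FinalStateConjecture.FinalStateConjecture.Theorems.KerrnessPropagates.KerrBasinCapture
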